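import Summits.HodgeConjecture.HodgeConjecture.Theorems.CYFormCasimirCYFormCarrierEightGeneralFrame
import HarnessLib

/-!
# Crux X1 `CYFormCarrierEight` (route `CYFormCasimir`, stmt-HodgeConjecture-23493), helper file 13:
# the pairing `β(z, y) = tr((z ∪ y) ∪ h_K⁴)` between `⋀⁴W` and `⋀⁴W^*` is PERFECT; row/column formulas in any frame

research route conditional on HC_CM; not a corollary. Nothing here proves HC, HC_CM, the rung H2, X1 or
`stub_cyform_exists`; step S2 of `Cruxes/CYFormCarrierEight/STUB-PLAN-stub_cyform_exists.md`: the Hodge star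
`s₊ : ⋀⁴W → ⋀⁴W^*` is defined by `β(z, s₊ x) = tr((z ∪ x) ∪ v)` (helper file 14), which needs `β` PERFECT.

For a Hodge-general (`Hg = SU_H`) `ℚ(√-d)`-Weil eightfold `(A, φ)` with `K`-symmetrised class `h_K`, `E₊ = ⋀⁴W =
weilClassesPlus A φ 2 d`, `E₋ = ⋀⁴W^* = weilClassesMinus A φ 2 d`, and ANY Weil frame `b = (w, w^*)` (helper file 12):
* `apply_eq_repr_mul` — a linear functional vanishing off one basis vector reads off one coordinate;
* `beta_row_frame`, `beta_col_frame` — for `y ∈ E₋`: `β(w_K, y) = y_{K} · β(w_K, w^*_K)`, for `z ∈ E₊`: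
  `β(z, w^*_K) = z_K · β(w_K, w^*_K)` (`β` is diagonal in every frame, helper file 12);
* `eq_zero_of_beta_eq_zero_right/left` — **`β` is non-degenerate in both slots** (in the tree's frame `bW` the diagonal
  is non-zero, helper file 10);
* `beta_frame_diag_ne_zero` — hence **the diagonal `β(w_I, w^*_I)` is non-zero in EVERY frame**;
* `tri_row_frame` — for `x ∈ E₊` and any `v`: `tr((w_J ∪ x) ∪ v) = x_{Jᶜ} · tr((w_J ∪ w_{Jᶜ}) ∪ v)`; `tri'_row_frame` for `E₋`.

References: vanGeemen1994HodgeAV (proof of Thm. 6.12), FriedmanLaza2013 (§3.5 Lemma 36), LangeBirkenhake1992 (Lemma 1.1.17).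
-/

-- `Summit.HodgeConjecture.HodgeConjecture.…` is the tree's mandated summit/problem namespace (single-problem summit).
set_option linter.dupNamespace false
noncomputable section

open CategoryTheory
open Literature.AlgebraicTopology.SingularHomology
open Literature.AlgebraicGeometry.Motives
open Literature.AlgebraicGeometry.HodgeTheory
open Literature.AlgebraicGeometry.VanGeemen1994

namespace Summit.HodgeConjecture.HodgeConjecture.Theorems.CYFormCarrier

/-! ## §0 Generic: a functional that kills all basis vectors but one -/

/-- If `y_s · L(b_s) = 0` for all `s ≠ s₀` then `L y = y_{s₀} · L(b_{s₀})`. [folklore] -/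
theorem apply_eq_repr_mul {ι M : Type*} [Fintype ι] [DecidableEq ι] [AddCommGroup M] [Module ℂ M]
    (B : Module.Basis ι ℂ M) (L : M →ₗ[ℂ] ℂ) (y : M) (s₀ : ι) (h : ∀ s, s ≠ s₀ → B.repr y s * L (B s) = 0) :
    L y = B.repr y s₀ * L (B s₀) := by
  conv_lhs => rw [← B.sum_repr y, map_sum]
  simp_rw [map_smul, smul_eq_mul]
  rw [Finset.sum_eq_single s₀ (fun s _ hs ↦ h s hs) (fun h' ↦ absurd (Finset.mem_univ s₀) h')]

/-! ## §1 Index sets: the two blocks -/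

section Index

variable {k q : ℕ}

/-- `I ↦ castAdd(I)` is injective on `q`-subsets. [folklore] -/
theorem map_castAddEmb_injective :
    Function.Injective (fun I : Set.powersetCard (Fin k) q ↦ Set.powersetCard.map q (Fin.castAddEmb k) I) := by
  intro I J h
  apply Subtype.ext
  have h' := congrArg Subtype.val h
  rw [Set.powersetCard.val_map, Set.powersetCard.val_map] at h'
  exact Finset.map_injective _ h'

/-- `K ↦ natAdd(K)` is injective on `q`-subsets. [folklore] -/
theorem map_natAddEmb_injective :
    Function.Injective (fun K : Set.powersetCard (Fin k) q ↦ Set.powersetCard.map q (Fin.natAddEmb k) K) := by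
  intro I J h
  apply Subtype.ext
  have h' := congrArg Subtype.val h
  rw [Set.powersetCard.val_map, Set.powersetCard.val_map] at h'
  exact Finset.map_injective _ h'

/-- A first-block index set has no second-block indices. [folklore] -/
theorem filter_natAdd_card_map_castAddEmb (I : Set.powersetCard (Fin k) q) :
    (Finset.univ.filter fun j : Fin k ↦ Fin.natAdd k j ∈ (Set.powersetCard.map q (Fin.castAddEmb k) I).val).card = 0 := by
  classical
  rw [Finset.card_eq_zero, Finset.filter_eq_empty_iff]
  intro j _
  rw [Set.powersetCard.val_map]
  exact CYFormSquare.natAdd_not_mem_map_castAddEmb'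

/-- A second-block index set has no first-block indices. [folklore] -/
theorem projW_card_map_natAddEmb (K : Set.powersetCard (Fin k) q) :
    (projW (Set.powersetCard.map q (Fin.natAddEmb k) K).val).card = 0 := by
  classical
  rw [Finset.card_eq_zero]
  ext i
  simp only [Finset.notMem_empty, iff_false]
  rw [CYFormSquare.mem_projW_iff, Set.powersetCard.val_map]
  exact CYFormSquare.castAdd_not_mem_map_natAddEmb'

/-- An index set without second-block indices is `castAdd(I)` for some `I`. [folklore] -/
theorem exists_eq_map_castAddEmb (s : Set.powersetCard (Fin (k + k)) q)
    (hs : (Finset.univ.filter fun j : Fin k ↦ Fin.natAdd k j ∈ s.val).card = 0) :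
    ∃ I : Set.powersetCard (Fin k) q, s = Set.powersetCard.map q (Fin.castAddEmb k) I := by
  classical
  have hcard : (projW s.val).card = q := by
    have := CYFormSquare.card_eq_card_projW_add s.val; rw [hs, add_zero, s.prop] at this; exact this.symm
  exact ⟨Set.powersetCard.ofCard hcard, Subtype.ext (by
    rw [Set.powersetCard.val_map, Set.powersetCard.val_ofCard]; exact CYFormSquare.eq_map_castAddEmb_projW hs)⟩

/-- An index set without first-block indices is `natAdd(K)` for some `K`. [folklore] -/
theorem exists_eq_map_natAddEmb (s : Set.powersetCard (Fin (k + k)) q) (hs : (projW s.val).card = 0) :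
    ∃ K : Set.powersetCard (Fin k) q, s = Set.powersetCard.map q (Fin.natAddEmb k) K := by
  classical
  have hcard : (Finset.univ.filter fun j : Fin k ↦ Fin.natAdd k j ∈ s.val).card = q := by
    have := CYFormSquare.card_eq_card_projW_add s.val; rw [hs, zero_add, s.prop] at this; exact this.symm
  exact ⟨Set.powersetCard.ofCard hcard, Subtype.ext (by
    rw [Set.powersetCard.val_map, Set.powersetCard.val_ofCard]; exact CYFormSquare.eq_map_natAddEmb_filter hs)⟩

/-- `(Iᶜ)ᶜ = I` for `q`-subsets of a `2q`-set. [folklore] -/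
theorem compl_compl_eq (hqk : q + q = Fintype.card (Fin k)) (I : Set.powersetCard (Fin k) q) :
    Set.powersetCard.compl hqk (Set.powersetCard.compl hqk I) = I :=
  Subtype.ext (by rw [Set.powersetCard.coe_compl, Set.powersetCard.coe_compl, compl_compl])

end Index

/-! ## §2 Row and column formulas for `β` and for the triple products, in any frame -/

section Rows

variable {A : AbelianVariety ℂ} {d : ℕ} {φ : A ⟶ A}
variable (hd : 0 < d) (hA : A.dim = 2 * 4) (hφ : φ ≫ φ = -(d • 𝟙 A))
  (e : ProjectiveEmbedding A.X) {a : complexBetti (projectiveSpace e.n ℂ) 2} (ha : IsRationalClass a)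
  (ha0 : a ≠ 0) (w : Module.Basis (Fin (2 * 4)) ℂ (eigW A φ d))
  (b : Module.Basis (Fin (2 * 4 + 2 * 4)) ℂ (complexBetti A.X 1))
  (hb : b = weilBasis (m := 2 * 4 - 1) (k := 2 * 4) (by omega) (by omega) hd hφ e ha ha0 w)

include hb hd hA hφ e ha ha0 in
/-- **Row formula**: for `y ∈ ⋀⁴W^*`, `β(w_K, y) = y_K · β(w_K, w^*_K)` in any frame (`y` has only `w^*`-coordinates,
`β` is diagonal). [cite: vanGeemen1994HodgeAV, proof of Thm. 6.12] -/
theorem beta_row_frame (hSU : HasHodgeGroupSU A φ 4 d (hK d φ e a)) (K : Set.powersetCard (Fin (2 * 4)) (2 * 2))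
    {y : complexBetti A.X (2 * 2)} (hy : y ∈ weilClassesMinus A φ 2 d) :
    topCoord (dim_eq_seven_add_one hA)
        (cupProduct (show 2 * 4 + 2 * 4 = 2 + 2 * 7 from rfl)
          (cupProduct (show 2 * 2 + 2 * 2 = 2 * 4 from rfl)
            (monB b (2 * 2) (Set.powersetCard.map (2 * 2) (Fin.castAddEmb (2 * 4)) K)) y)
          (cupPowTwo (hK d φ e a) 4)) =
      (monB b (2 * 2)).repr y (Set.powersetCard.map (2 * 2) (Fin.natAddEmb (2 * 4)) K) *
        topCoord (dim_eq_seven_add_one hA)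
          (cupProduct (show 2 * 4 + 2 * 4 = 2 + 2 * 7 from rfl)
            (cupProduct (show 2 * 2 + 2 * 2 = 2 * 4 from rfl)
              (monB b (2 * 2) (Set.powersetCard.map (2 * 2) (Fin.castAddEmb (2 * 4)) K))
              (monB b (2 * 2) (Set.powersetCard.map (2 * 2) (Fin.natAddEmb (2 * 4)) K)))
            (cupPowTwo (hK d φ e a) 4)) := by
  classical
  set L : complexBetti A.X (2 * 2) →ₗ[ℂ] ℂ := topCoord (dim_eq_seven_add_one hA) ∘ₗ
    ((cupProduct (show 2 * 4 + 2 * 4 = 2 + 2 * 7 from rfl)).flip (cupPowTwo (hK d φ e a) 4)) ∘ₗ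
      (cupProduct (show 2 * 2 + 2 * 2 = 2 * 4 from rfl)
        (monB b (2 * 2) (Set.powersetCard.map (2 * 2) (Fin.castAddEmb (2 * 4)) K))) with hL
  have hLapp : ∀ t, L t = topCoord (dim_eq_seven_add_one hA)
      (cupProduct (show 2 * 4 + 2 * 4 = 2 + 2 * 7 from rfl)
        (cupProduct (show 2 * 2 + 2 * 2 = 2 * 4 from rfl)
          (monB b (2 * 2) (Set.powersetCard.map (2 * 2) (Fin.castAddEmb (2 * 4)) K)) t)
        (cupPowTwo (hK d φ e a) 4)) := fun t ↦ rfl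
  rw [← hLapp, ← hLapp]
  refine apply_eq_repr_mul (monB b (2 * 2)) L y _ fun s hs ↦ ?_
  by_cases hs0 : (projW s.val).card = 0
  · obtain ⟨K', rfl⟩ := exists_eq_map_natAddEmb s hs0
    have hne : K ≠ K' := fun h ↦ hs (by rw [h])
    rw [hLapp, beta_frame_eq_zero_of_ne hd hA hφ e ha ha0 w b hb hSU K K' hne, mul_zero]
  · rw [repr_frame_eq_zero_of_mem_weilClassesMinus_two hd hA hφ e ha ha0 w b hb hy s hs0, zero_mul]

include hb hd hA hφ e ha ha0 in
/-- **Column formula**: for `z ∈ ⋀⁴W`, `β(z, w^*_K) = z_K · β(w_K, w^*_K)` in any frame.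
[cite: vanGeemen1994HodgeAV, proof of Thm. 6.12] -/
theorem beta_col_frame (hSU : HasHodgeGroupSU A φ 4 d (hK d φ e a)) (K : Set.powersetCard (Fin (2 * 4)) (2 * 2))
    {z : complexBetti A.X (2 * 2)} (hz : z ∈ weilClassesPlus A φ 2 d) :
    topCoord (dim_eq_seven_add_one hA)
        (cupProduct (show 2 * 4 + 2 * 4 = 2 + 2 * 7 from rfl)
          (cupProduct (show 2 * 2 + 2 * 2 = 2 * 4 from rfl) z
            (monB b (2 * 2) (Set.powersetCard.map (2 * 2) (Fin.natAddEmb (2 * 4)) K)))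
          (cupPowTwo (hK d φ e a) 4)) =
      (monB b (2 * 2)).repr z (Set.powersetCard.map (2 * 2) (Fin.castAddEmb (2 * 4)) K) *
        topCoord (dim_eq_seven_add_one hA)
          (cupProduct (show 2 * 4 + 2 * 4 = 2 + 2 * 7 from rfl)
            (cupProduct (show 2 * 2 + 2 * 2 = 2 * 4 from rfl)
              (monB b (2 * 2) (Set.powersetCard.map (2 * 2) (Fin.castAddEmb (2 * 4)) K))
              (monB b (2 * 2) (Set.powersetCard.map (2 * 2) (Fin.natAddEmb (2 * 4)) K)))
            (cupPowTwo (hK d φ e a) 4)) := by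
  classical
  set L : complexBetti A.X (2 * 2) →ₗ[ℂ] ℂ := topCoord (dim_eq_seven_add_one hA) ∘ₗ
    ((cupProduct (show 2 * 4 + 2 * 4 = 2 + 2 * 7 from rfl)).flip (cupPowTwo (hK d φ e a) 4)) ∘ₗ
      ((cupProduct (show 2 * 2 + 2 * 2 = 2 * 4 from rfl)).flip
        (monB b (2 * 2) (Set.powersetCard.map (2 * 2) (Fin.natAddEmb (2 * 4)) K))) with hL
  have hLapp : ∀ t, L t = topCoord (dim_eq_seven_add_one hA)
      (cupProduct (show 2 * 4 + 2 * 4 = 2 + 2 * 7 from rfl)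
        (cupProduct (show 2 * 2 + 2 * 2 = 2 * 4 from rfl) t
          (monB b (2 * 2) (Set.powersetCard.map (2 * 2) (Fin.natAddEmb (2 * 4)) K)))
        (cupPowTwo (hK d φ e a) 4)) := fun t ↦ rfl
  rw [← hLapp, ← hLapp]
  refine apply_eq_repr_mul (monB b (2 * 2)) L z _ fun s hs ↦ ?_
  by_cases hs0 : (Finset.univ.filter fun j : Fin (2 * 4) ↦ Fin.natAdd (2 * 4) j ∈ s.val).card = 0
  · obtain ⟨K', rfl⟩ := exists_eq_map_castAddEmb s hs0
    have hne : K' ≠ K := fun h ↦ hs (by rw [h])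
    rw [hLapp, beta_frame_eq_zero_of_ne hd hA hφ e ha ha0 w b hb hSU K' K hne, mul_zero]
  · rw [repr_frame_eq_zero_of_mem_weilClassesPlus_two hd hA hφ e ha ha0 w b hb hz s hs0, zero_mul]

include hb hd in
/-- **Row formula for the triple product against `⋀⁴W`**: for `x ∈ ⋀⁴W` and any `v ∈ H⁸`,
`tr((w_J ∪ x) ∪ v) = x_{Jᶜ} · tr((w_J ∪ w_{Jᶜ}) ∪ v)` (`w_J ∪ w_I = 0` unless `I = Jᶜ`). [cite: LangeBirkenhake1992, Lemma 1.1.17] -/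
theorem tri_row_frame (hqk : 2 * 2 + 2 * 2 = Fintype.card (Fin (2 * 4))) (J : Set.powersetCard (Fin (2 * 4)) (2 * 2))
    (v : complexBetti A.X (2 * 4)) {x : complexBetti A.X (2 * 2)} (hx : x ∈ weilClassesPlus A φ 2 d) :
    topCoord (dim_eq_seven_add_one hA)
        (cupProduct (show 2 * 4 + 2 * 4 = 2 + 2 * 7 from rfl)
          (cupProduct (show 2 * 2 + 2 * 2 = 2 * 4 from rfl)
            (monB b (2 * 2) (Set.powersetCard.map (2 * 2) (Fin.castAddEmb (2 * 4)) J)) x) v) =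
      (monB b (2 * 2)).repr x (Set.powersetCard.map (2 * 2) (Fin.castAddEmb (2 * 4)) (Set.powersetCard.compl hqk J)) *
        topCoord (dim_eq_seven_add_one hA)
          (cupProduct (show 2 * 4 + 2 * 4 = 2 + 2 * 7 from rfl)
            (cupProduct (show 2 * 2 + 2 * 2 = 2 * 4 from rfl)
              (monB b (2 * 2) (Set.powersetCard.map (2 * 2) (Fin.castAddEmb (2 * 4)) J))
              (monB b (2 * 2) (Set.powersetCard.map (2 * 2) (Fin.castAddEmb (2 * 4))
                (Set.powersetCard.compl hqk J)))) v) := by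
  classical
  set L : complexBetti A.X (2 * 2) →ₗ[ℂ] ℂ := topCoord (dim_eq_seven_add_one hA) ∘ₗ
    ((cupProduct (show 2 * 4 + 2 * 4 = 2 + 2 * 7 from rfl)).flip v) ∘ₗ
      (cupProduct (show 2 * 2 + 2 * 2 = 2 * 4 from rfl)
        (monB b (2 * 2) (Set.powersetCard.map (2 * 2) (Fin.castAddEmb (2 * 4)) J))) with hL
  have hLapp : ∀ t, L t = topCoord (dim_eq_seven_add_one hA)
      (cupProduct (show 2 * 4 + 2 * 4 = 2 + 2 * 7 from rfl)
        (cupProduct (show 2 * 2 + 2 * 2 = 2 * 4 from rfl)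
          (monB b (2 * 2) (Set.powersetCard.map (2 * 2) (Fin.castAddEmb (2 * 4)) J)) t) v) := fun t ↦ rfl
  rw [← hLapp, ← hLapp]
  refine apply_eq_repr_mul (monB b (2 * 2)) L x _ fun s hs ↦ ?_
  by_cases hs0 : (Finset.univ.filter fun j : Fin (2 * 4) ↦ Fin.natAdd (2 * 4) j ∈ s.val).card = 0
  · obtain ⟨I, rfl⟩ := exists_eq_map_castAddEmb s hs0
    have hne : I ≠ Set.powersetCard.compl hqk J := fun h ↦ hs (by rw [h])
    -- `w_J ∪ w_I = 0` since `I ≠ Jᶜ`, i.e. `J ≠ Iᶜ`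
    have hne' : J ≠ Set.powersetCard.compl hqk I := fun h ↦ hne (by rw [h, compl_compl_eq])
    rw [hLapp, cup_frame_castAdd_eq_zero_of_ne_compl b hqk I J hne', LinearMap.map_zero₂, map_zero, mul_zero]
  · rw [repr_frame_eq_zero_of_mem_weilClassesPlus_two hd hA hφ e ha ha0 w b hb hx s hs0, zero_mul]

include hb hd in
/-- **Row formula for the triple product against `⋀⁴W^*`**: for `y ∈ ⋀⁴W^*` and any `v ∈ H⁸`,
`tr((w^*_L ∪ y) ∪ v) = y_{Lᶜ} · tr((w^*_L ∪ w^*_{Lᶜ}) ∪ v)`. [cite: LangeBirkenhake1992, Lemma 1.1.17] -/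
theorem tri'_row_frame (hqk : 2 * 2 + 2 * 2 = Fintype.card (Fin (2 * 4))) (L₀ : Set.powersetCard (Fin (2 * 4)) (2 * 2))
    (v : complexBetti A.X (2 * 4)) {y : complexBetti A.X (2 * 2)} (hy : y ∈ weilClassesMinus A φ 2 d) :
    topCoord (dim_eq_seven_add_one hA)
        (cupProduct (show 2 * 4 + 2 * 4 = 2 + 2 * 7 from rfl)
          (cupProduct (show 2 * 2 + 2 * 2 = 2 * 4 from rfl)
            (monB b (2 * 2) (Set.powersetCard.map (2 * 2) (Fin.natAddEmb (2 * 4)) L₀)) y) v) =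
      (monB b (2 * 2)).repr y (Set.powersetCard.map (2 * 2) (Fin.natAddEmb (2 * 4)) (Set.powersetCard.compl hqk L₀)) *
        topCoord (dim_eq_seven_add_one hA)
          (cupProduct (show 2 * 4 + 2 * 4 = 2 + 2 * 7 from rfl)
            (cupProduct (show 2 * 2 + 2 * 2 = 2 * 4 from rfl)
              (monB b (2 * 2) (Set.powersetCard.map (2 * 2) (Fin.natAddEmb (2 * 4)) L₀))
              (monB b (2 * 2) (Set.powersetCard.map (2 * 2) (Fin.natAddEmb (2 * 4))
                (Set.powersetCard.compl hqk L₀)))) v) := by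
  classical
  set L : complexBetti A.X (2 * 2) →ₗ[ℂ] ℂ := topCoord (dim_eq_seven_add_one hA) ∘ₗ
    ((cupProduct (show 2 * 4 + 2 * 4 = 2 + 2 * 7 from rfl)).flip v) ∘ₗ
      (cupProduct (show 2 * 2 + 2 * 2 = 2 * 4 from rfl)
        (monB b (2 * 2) (Set.powersetCard.map (2 * 2) (Fin.natAddEmb (2 * 4)) L₀))) with hL
  have hLapp : ∀ t, L t = topCoord (dim_eq_seven_add_one hA)
      (cupProduct (show 2 * 4 + 2 * 4 = 2 + 2 * 7 from rfl)
        (cupProduct (show 2 * 2 + 2 * 2 = 2 * 4 from rfl)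
          (monB b (2 * 2) (Set.powersetCard.map (2 * 2) (Fin.natAddEmb (2 * 4)) L₀)) t) v) := fun t ↦ rfl
  rw [← hLapp, ← hLapp]
  refine apply_eq_repr_mul (monB b (2 * 2)) L y _ fun s hs ↦ ?_
  by_cases hs0 : (projW s.val).card = 0
  · obtain ⟨K, rfl⟩ := exists_eq_map_natAddEmb s hs0
    have hne : K ≠ Set.powersetCard.compl hqk L₀ := fun h ↦ hs (by rw [h])
    have hne' : L₀ ≠ Set.powersetCard.compl hqk K := fun h ↦ hne (by rw [h, compl_compl_eq])
    rw [hLapp, cup_frame_natAdd_eq_zero_of_ne_compl b hqk K L₀ hne', LinearMap.map_zero₂, map_zero, mul_zero]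
  · rw [repr_frame_eq_zero_of_mem_weilClassesMinus_two hd hA hφ e ha ha0 w b hb hy s hs0, zero_mul]

end Rows

/-! ## §3 `β` is non-degenerate (tree frame `bW`: non-zero diagonal, helper file 10) -/

section Nondegenerate

variable {A : AbelianVariety ℂ} {d : ℕ} {φ : A ⟶ A}
variable (hd : 0 < d) (hA : A.dim = 2 * 4) (hφ : φ ≫ φ = -(d • 𝟙 A))
  (e : ProjectiveEmbedding A.X) {a : complexBetti (projectiveSpace e.n ℂ) 2} (ha : IsRationalClass a)
  (ha0 : a ≠ 0)

include hd hA hφ e ha ha0 in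
/-- **`β` is non-degenerate in the second slot**: a class `y ∈ ⋀⁴W^*` with `β(z, y) = 0` for all `z ∈ ⋀⁴W` vanishes
(test with `z = w_K` of the tree's frame `bW`: `y_K β(w_K, w^*_K) = 0` and the diagonal is non-zero).
[cite: vanGeemen1994HodgeAV, proof of Thm. 6.12] [cite: FriedmanLaza2013, §3.5 Lemma 36] -/
theorem eq_zero_of_beta_eq_zero_right (hSU : HasHodgeGroupSU A φ 4 d (hK d φ e a))
    {y : complexBetti A.X (2 * 2)} (hy : y ∈ weilClassesMinus A φ 2 d)
    (h : ∀ z ∈ weilClassesPlus A φ 2 d, topCoord (dim_eq_seven_add_one hA)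
        (cupProduct (show 2 * 4 + 2 * 4 = 2 + 2 * 7 from rfl)
          (cupProduct (show 2 * 2 + 2 * 2 = 2 * 4 from rfl) z y) (cupPowTwo (hK d φ e a) 4)) = 0) :
    y = 0 := by
  classical
  set b := bW (by omega : 2 ≤ 4) hd hA hφ e ha ha0 with hbdef
  have hb : b = weilBasis (m := 2 * 4 - 1) (k := 2 * 4) (by omega) (by omega) hd hφ e ha ha0 (wBasis hd hφ hA) := rfl
  set B := monB b (2 * 2) with hB
  have hzero : ∀ s, B.repr y s = 0 := by
    intro s
    by_cases hs0 : (projW s.val).card = 0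
    · obtain ⟨K, rfl⟩ := exists_eq_map_natAddEmb s hs0
      have hrow := beta_row_frame hd hA hφ e ha ha0 (wBasis hd hφ hA) b hb hSU K hy
      rw [h _ (monB_frame_castAdd_mem_weilClassesPlus hd hA hφ e ha ha0 (wBasis hd hφ hA) b hb K)] at hrow
      have hdiag := beta_monB_diag_ne_zero (by omega) hd hA hφ e ha ha0 hSU K
      exact (mul_eq_zero.1 hrow.symm).resolve_right hdiag
    · exact repr_frame_eq_zero_of_mem_weilClassesMinus_two hd hA hφ e ha ha0 (wBasis hd hφ hA) b hb hy s hs0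
  rw [← B.sum_repr y]
  exact Finset.sum_eq_zero fun s _ ↦ by rw [hzero s, zero_smul]

include hd hA hφ e ha ha0 in
/-- **`β` is non-degenerate in the first slot**: a class `z ∈ ⋀⁴W` with `β(z, y) = 0` for all `y ∈ ⋀⁴W^*` vanishes.
[cite: vanGeemen1994HodgeAV, proof of Thm. 6.12] [cite: FriedmanLaza2013, §3.5 Lemma 36] -/
theorem eq_zero_of_beta_eq_zero_left (hSU : HasHodgeGroupSU A φ 4 d (hK d φ e a))
    {z : complexBetti A.X (2 * 2)} (hz : z ∈ weilClassesPlus A φ 2 d)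
    (h : ∀ y ∈ weilClassesMinus A φ 2 d, topCoord (dim_eq_seven_add_one hA)
        (cupProduct (show 2 * 4 + 2 * 4 = 2 + 2 * 7 from rfl)
          (cupProduct (show 2 * 2 + 2 * 2 = 2 * 4 from rfl) z y) (cupPowTwo (hK d φ e a) 4)) = 0) :
    z = 0 := by
  classical
  set b := bW (by omega : 2 ≤ 4) hd hA hφ e ha ha0 with hbdef
  have hb : b = weilBasis (m := 2 * 4 - 1) (k := 2 * 4) (by omega) (by omega) hd hφ e ha ha0 (wBasis hd hφ hA) := rfl
  set B := monB b (2 * 2) with hB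
  have hzero : ∀ s, B.repr z s = 0 := by
    intro s
    by_cases hs0 : (Finset.univ.filter fun j : Fin (2 * 4) ↦ Fin.natAdd (2 * 4) j ∈ s.val).card = 0
    · obtain ⟨K, rfl⟩ := exists_eq_map_castAddEmb s hs0
      have hcol := beta_col_frame hd hA hφ e ha ha0 (wBasis hd hφ hA) b hb hSU K hz
      rw [h _ (monB_frame_natAdd_mem_weilClassesMinus hd hA hφ e ha ha0 (wBasis hd hφ hA) b hb K)] at hcol
      have hdiag := beta_monB_diag_ne_zero (by omega) hd hA hφ e ha ha0 hSU K
      exact (mul_eq_zero.1 hcol.symm).resolve_right hdiag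
    · exact repr_frame_eq_zero_of_mem_weilClassesPlus_two hd hA hφ e ha ha0 (wBasis hd hφ hA) b hb hz s hs0
  rw [← B.sum_repr z]
  exact Finset.sum_eq_zero fun s _ ↦ by rw [hzero s, zero_smul]

/-! ## §4 The diagonal of `β` is non-zero in every frame -/

variable (w : Module.Basis (Fin (2 * 4)) ℂ (eigW A φ d))
  (b : Module.Basis (Fin (2 * 4 + 2 * 4)) ℂ (complexBetti A.X 1))
  (hb : b = weilBasis (m := 2 * 4 - 1) (k := 2 * 4) (by omega) (by omega) hd hφ e ha ha0 w)

include hb hd hA hφ e ha ha0 in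
/-- **`β(w_I, w^*_I) ≠ 0` in EVERY Weil frame**: otherwise the whole row `β(w_I, ·)` vanishes on `⋀⁴W^*`
(off-diagonal entries vanish, helper file 12) and `w_I = 0` by non-degeneracy. [cite: vanGeemen1994HodgeAV, proof of Thm. 6.12]
[cite: FriedmanLaza2013, §3.5 Lemma 36] -/
theorem beta_frame_diag_ne_zero (hSU : HasHodgeGroupSU A φ 4 d (hK d φ e a)) (I : Set.powersetCard (Fin (2 * 4)) (2 * 2)) :
    topCoord (dim_eq_seven_add_one hA)
        (cupProduct (show 2 * 4 + 2 * 4 = 2 + 2 * 7 from rfl)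
          (cupProduct (show 2 * 2 + 2 * 2 = 2 * 4 from rfl)
            (monB b (2 * 2) (Set.powersetCard.map (2 * 2) (Fin.castAddEmb (2 * 4)) I))
            (monB b (2 * 2) (Set.powersetCard.map (2 * 2) (Fin.natAddEmb (2 * 4)) I)))
          (cupPowTwo (hK d φ e a) 4)) ≠ 0 := by
  classical
  intro h0
  have hz : monB b (2 * 2) (Set.powersetCard.map (2 * 2) (Fin.castAddEmb (2 * 4)) I) ∈ weilClassesPlus A φ 2 d :=
    monB_frame_castAdd_mem_weilClassesPlus hd hA hφ e ha ha0 w b hb I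
  have hall : ∀ y ∈ weilClassesMinus A φ 2 d, topCoord (dim_eq_seven_add_one hA)
      (cupProduct (show 2 * 4 + 2 * 4 = 2 + 2 * 7 from rfl)
        (cupProduct (show 2 * 2 + 2 * 2 = 2 * 4 from rfl)
          (monB b (2 * 2) (Set.powersetCard.map (2 * 2) (Fin.castAddEmb (2 * 4)) I)) y)
        (cupPowTwo (hK d φ e a) 4)) = 0 := by
    intro y hy
    rw [beta_row_frame hd hA hφ e ha ha0 w b hb hSU I hy, h0, mul_zero]
  have h := eq_zero_of_beta_eq_zero_left hd hA hφ e ha ha0 hSU hz hall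
  exact (monB b (2 * 2)).ne_zero _ h

end Nondegenerate

end Summit.HodgeConjecture.HodgeConjecture.Theorems.CYFormCarrier

end
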